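import Summits.QuantumFields.BalabanUV.Beta.FP.TorusCompositeRowsSymPeriodic
import Summits.QuantumFields.BalabanUV.Beta.CompositeVertexKernelRec

/-!
# `BalabanUV.Beta.FP.TorusCompositeRowsSymKernel` — road «FP» for binder row D1, ROUTE T (β1), J-RISK-3′ «THE PACKING AT THE PASS», (B1) of SPEC-48:
# **leaf-06's (0.4)-SYMMETRISED COMPOSITE ROWS `compRowsSym` ARE THE FINEST-TORUS PERIODISATION OF an2's COMPOSITE LINEAR AVERAGING KERNEL `compLinKer`
# AT THE SYM BRICKS — WITH THE TWO ENGINE LETTERS OF THAT LEG (EQUIVARIANCE, FINITE WINDOW)**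

WHY.  The packing engine `FP/TorusTwoScaleSandwichPeriodic.transpose_mul_perF_dper_mul` (g36, SPEC-48 §A) turns ONE storey of leaf-06's companion sum
`(compRowsSym …)ᵀ * G * compRowsSym …` into the periodisation of ONE lattice sandwich, PROVIDED the conjugating rows are displayed as `Cm p q = Σ'_m CL p (q + Tf∘m)`
for a two-scale lattice leg `CL` that is EQUIVARIANT under simultaneous translation by the two period vectors and finitely WINDOWED in the coarse site.  This file
supplies exactly that for `Cm := compRowsSym Lc M lev rs n` (rows `↥(pbox M) × Fin (d+1)`, columns `↥(pbox (towerTorus Lc M n)) × Fin (d+1)`): the leg is an2's F3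
`CompositeVertexKernelRec.compLinKer ℓ Lc n` (fine bond FIRST, coarse bond SECOND) at the brick list `ℓ i μ y g = stepScale d Lc (lev (n − i)) · Lc^{d+1} ·
symLinKerAt (ctr (d+1) Lc) Lc μ y g` (an2 counts levels from the bottom, leaf-06 from the top; the brick list is DISPLAYED by `hℓ` below the depth only, so the same
`ℓ` serves every sub-composite of the induction).

WHAT ([folklore] finite-sum ∕ finitely-supported-`tsum` bookkeeping BY NAME over OUR objects; no `def`, no `def … : Prop`, nothing cited, 0 sorry):
* §1 an2's `compLinKer` under brick letters displayed BELOW THE DEPTH: `compLinKer_sh` (EQUIVARIANCE: bricks covariant under block translation ⟹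
  `compLinKer ℓ L n (f.sh (L^n • t)) (g.sh t) = compLinKer ℓ L n f g`), `finite_compLinKer_ne_zero_right` (for a fixed fine bond the coarse bonds with a non-zero
  coefficient are finitely many — NO letter of the bricks needed, the recursion enumerates the windows `offs L`), `finite_compLinKer_ne_zero_left` (for a fixed coarse
  bond the fine bonds are finitely many), `translate_eq_iff_of_mem_pbox` (two box points differ by a period only trivially; `GAN24.KernelPeriodisation.quo_translate`).
* §2 **`compRowsSym_apply_eq_tsum_compLinKer`**: for `ℓ` with `hℓ : ∀ i < n, ℓ i μ y g = stepScale d Lc (lev (n − i)) · (Lc^{d+1} · symLinKerAt (ctr (d+1) Lc) Lc μ y g)`,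
  `compRowsSym Lc M lev rs n (x, κ) q = Σ'_m compLinKer ℓ Lc n (q.2, q.1 + (towerTorus Lc M n)∘m) (κ, x)` — induction on the depth exactly as leaf-02's
  `TorusCompositeRowsSymPeriodic.sum_compRowsSym_mul_periodic_of_clauses` (top peel `compRowsSym_succ` ∕ an2's `compLinKer_succ`; leaf-02's `sum_QstepSym_mul_periodic` at the
  `fine Lc M`-periodic form `z ↦ Σ'_m compLinKer ℓ Lc n (q + T∘m) (l, z)`; the brick's window `near_iff_exists_offs` ∕ `symLinKerAt_eq_zero`; depth `0` = the box
  uniqueness of §1).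
* §3 THE ENGINE's LETTERS FOR THIS LEG, in the shapes `transpose_mul_perF_dper_mul` consumes (`CL γ a β b := compLinKer ℓ Lc n (b, β) (a, γ)`, `Tc := M`,
  `Tf := towerTorus Lc M n`): `rowsLeg_translate` (its `hCL`, from `symLinKerAt_add`), `exists_rowsLeg_window` (its `S ∕ hS`), `compRowsSym_eq_periodised_leg` (its `hCm ∕ hC`
  with `Cm := compRowsSym Lc M lev rs n`).
WHAT THIS IS NOT: not the storey core, not the storey sum, not an2's contracted unrolling ((B2)–(B4) of SPEC-48); no row of the END wrapper discharged; no estimate;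
nothing of Bałaban's asserted, valued or discharged; 0∕4 row-D1 binders (hW, hR, D1Tel, D1Rep); NOT (C1), NOT (T-ID), NOT SDF, NOT D1, NOT BetaPertH, NOT continuum, NOT Clay.

HONEST DEPENDENCY (page 1, mandatory): continuum YM on T⁴ ⇐ BetaPertH ∧ nine spine estimates (0/9 proved); BetaPertH ⇐ (D1) ∧ (D4) ∧ CAP+tail;
G-an2-4 gates asym, D1 and NE2/3/4.  HONEST FRAMING (cell contract, verbatim): «discharging `BetaPertH` makes Bałaban's UV stability UNCONDITIONAL —
a real constructive-QFT result; it is NOT the continuum limit and NOT the Clay problem.»  ABSOLUTE RULE (cell charter, verbatim): «No internally-minted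
statement may enter as a cited fact. Every hypothesis is either kernel-proved in this package or a verbatim quotation of a PUBLISHED theorem with page
reference. The manuscript(s) under audit are NOT citable for their own disputed steps — they are the thing under adjudication; programme-internal
(2001/route/tribunal) claims are never citable.»  Road «FP» OWNER, b2b-balaban-beta-d1-p3 gen 36, 2026-08-25.  No existing file touched.
-/

noncomputable section

open scoped BigOperators

namespace Summit.QuantumFields.BalabanUV.Beta.FP.TorusCompositeRowsSymKernel

open Finset Matrix
open Literature.MathematicalPhysics.QuantumFieldTheory.Balaban1983to89
open Literature.MathematicalPhysics.QuantumFieldTheory.Balaban1983to89.Beta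
open B4TorusKernel.MultiPeriod (translate translate_injective)
open B4Reflection242 (translate_translate)
open B5Prop11Plancherel (fine)
open B6Lemma24Torus (pbox mem_pbox)
open AffineAveraging (Site Form1 box toSite)
open AveragingHessianKernels (Bond Near)
open AveragingContoursRooted (ctr ctrOff ctrOff_mem_box)
open Summit.QuantumFields.BalabanUV.Beta.SymAveragingHessianCounts (symLinKerAt symLinKerAt_add symLinKerAt_eq_zero)
open Summit.QuantumFields.BalabanUV.Beta.BorderedHessian (stepScale)
open Summit.QuantumFields.BalabanUV.Beta.CompositeVertexKernelRec (offs near_iff_exists_offs smul_add_right_injective compLinKer compLinKer_zero compLinKer_succ)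
open Summit.QuantumFields.BalabanUV.Beta.FP.TorusCompositeObjects (towerTorus towerTorus_apply)
open Summit.QuantumFields.BalabanUV.Beta.FP.TorusCompositeObjectsG (QstepSym compRowsSym compRowsSym_succ)
open Summit.QuantumFields.BalabanUV.Beta.FP.TorusCompositeRowsSymPeriodic (sum_QstepSym_mul_periodic)
open Summit.QuantumFields.BalabanUV.Beta.GAN24.KernelPeriodisation (quo quo_translate)

variable {d : ℕ}

/-! ## §1 an2's composite linear kernel under brick letters displayed below the depth -/

section Letters

variable (ℓ : ℕ → Fin (d + 1) → Site (d + 1) → Bond (d + 1) → ℝ) (L : ℕ)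

/-- [folklore] **EQUIVARIANCE OF THE COMPOSITE LEG**: if every brick below the depth is covariant under block translation (`ℓ i μ (y + t) (g.sh (L•t)) = ℓ i μ y g`,
`i < n`), then translating the coarse bond by `t` and the fine bond by `L^n • t` leaves the `n`-fold composite coefficient unchanged. -/
theorem compLinKer_sh : ∀ (n : ℕ) (_ : ∀ i < n, ∀ (μ : Fin (d + 1)) (y t : Site (d + 1)) (g : Bond (d + 1)), ℓ i μ (y + t) (g.sh ((L : ℤ) • t)) = ℓ i μ y g)
    (f g : Bond (d + 1)) (t : Site (d + 1)), compLinKer ℓ L n (f.sh (((L : ℤ) ^ n) • t)) (g.sh t) = compLinKer ℓ L n f g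
  | 0, _, f, g, t => by
      simp only [compLinKer_zero, pow_zero, one_smul]
      have h : g.sh t = f.sh t ↔ g = f := by
        constructor
        · intro h
          have h1 := congrArg Prod.fst h
          have h2 := congrArg Prod.snd h
          simp only [Bond.sh] at h1 h2
          exact Prod.ext h1 (add_right_cancel h2)
        · rintro rfl; rfl
      rw [if_congr h rfl rfl]
  | n + 1, hT, f, g, t => by
      rw [compLinKer_succ, compLinKer_succ]
      refine Finset.sum_congr rfl fun κ _ => Finset.sum_congr rfl fun e _ => ?_
      have hb : ((κ, (L : ℤ) • (g.sh t).2 + e) : Bond (d + 1)) = Bond.sh (κ, (L : ℤ) • g.2 + e) ((L : ℤ) • t) := by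
        refine Prod.ext rfl ?_
        simp only [Bond.sh, smul_add]
        abel
      have h1 : (g.sh t).1 = g.1 := rfl
      have h2 : (g.sh t).2 = g.2 + t := rfl
      rw [hb, h1, h2, hT n (Nat.lt_succ_self n), show ((L : ℤ) ^ (n + 1)) • t = ((L : ℤ) ^ n) • ((L : ℤ) • t) by rw [pow_succ, mul_smul],
        compLinKer_sh n (fun i hi => hT i (Nat.lt_succ_of_lt hi)) f _ ((L : ℤ) • t)]

/-- [folklore] **THE COARSE WINDOW OF A FINE BOND IS FINITE**: for a fixed fine bond `f` only finitely many coarse bonds `g` carry a non-zero `n`-fold coefficient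
(no letter of the bricks: the recursion enumerates the windows `offs L` itself; `L ≠ 0`). -/
theorem finite_compLinKer_ne_zero_right (hL : L ≠ 0) : ∀ (n : ℕ) (f : Bond (d + 1)), Set.Finite {g : Bond (d + 1) | compLinKer ℓ L n f g ≠ 0}
  | 0, f => by
      refine (Set.finite_singleton f).subset fun g hg => ?_
      simp only [Set.mem_setOf_eq, compLinKer_zero, ne_eq, ite_eq_right_iff, one_ne_zero, imp_false, not_not] at hg
      exact hg
  | n + 1, f => by
      have hL' : (L : ℤ) ≠ 0 := Int.natCast_ne_zero.mpr hL
      have hfin := ((finite_compLinKer_ne_zero_right hL n f).prod ((offs (d := d) L).finite_toSet.prod (Set.finite_univ (α := Fin (d + 1))))).image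
        (fun p : Bond (d + 1) × (Site (d + 1) × Fin (d + 1)) => ((p.2.2, fun i => (p.1.2 i - p.2.1 i) / (L : ℤ)) : Bond (d + 1)))
      refine hfin.subset fun g hg => ?_
      simp only [Set.mem_setOf_eq, compLinKer_succ] at hg
      obtain ⟨κ, -, hκ⟩ := Finset.exists_ne_zero_of_sum_ne_zero hg
      obtain ⟨e, he, hne⟩ := Finset.exists_ne_zero_of_sum_ne_zero hκ
      refine ⟨((κ, (L : ℤ) • g.2 + e), (e, g.1)), ⟨(mul_ne_zero_iff.1 hne).2, Finset.mem_coe.2 he, Set.mem_univ _⟩, ?_⟩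
      refine Prod.ext rfl (funext fun i => ?_)
      simp only [Pi.add_apply, Pi.smul_apply, smul_eq_mul, add_sub_cancel_right]
      exact Int.mul_ediv_cancel_left _ hL'

/-- [folklore] **THE FINE SUPPORT OF A COARSE BOND IS FINITE**: for a fixed coarse bond `g` only finitely many fine bonds `f` carry a non-zero `n`-fold coefficient. -/
theorem finite_compLinKer_ne_zero_left : ∀ (n : ℕ) (g : Bond (d + 1)), Set.Finite {f : Bond (d + 1) | compLinKer ℓ L n f g ≠ 0}
  | 0, g => by
      refine (Set.finite_singleton g).subset fun f hf => ?_
      simp only [Set.mem_setOf_eq, compLinKer_zero, ne_eq, ite_eq_right_iff, one_ne_zero, imp_false, not_not] at hf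
      exact hf.symm
  | n + 1, g => by
      have hfin : Set.Finite (⋃ κ : Fin (d + 1), ⋃ e ∈ (offs (d := d) L), {f : Bond (d + 1) | compLinKer ℓ L n f (κ, (L : ℤ) • g.2 + e) ≠ 0}) :=
        Set.finite_iUnion fun κ => (offs (d := d) L).finite_toSet.biUnion fun e _ => finite_compLinKer_ne_zero_left n _
      refine hfin.subset fun f hf => ?_
      simp only [Set.mem_setOf_eq, compLinKer_succ] at hf
      obtain ⟨κ, -, hκ⟩ := Finset.exists_ne_zero_of_sum_ne_zero hf
      obtain ⟨e, he, hne⟩ := Finset.exists_ne_zero_of_sum_ne_zero hκ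
      exact Set.mem_iUnion.2 ⟨κ, Set.mem_biUnion (Finset.mem_coe.2 he) (mul_ne_zero_iff.1 hne).2⟩

end Letters

/-- [folklore] translating by the zero multi-index is the identity. -/
theorem translate_zero' (T : Fin (d + 1) → ℕ) (x : Site (d + 1)) : translate T x 0 = x := by
  funext i; simp only [B4TorusKernel.MultiPeriod.translate_apply, Pi.zero_apply, mul_zero, add_zero]

/-- [folklore] **TWO BOX POINTS DIFFER BY A PERIOD ONLY TRIVIALLY**: for `x, y ∈ pbox T`, `x = y + T∘m ↔ m = 0 ∧ x = y` (`quo_translate`). -/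
theorem translate_eq_iff_of_mem_pbox (T : Fin (d + 1) → ℕ) [∀ μ, NeZero (T μ)] {x y : Site (d + 1)} (hx : x ∈ pbox T) (hy : y ∈ pbox T)
    (m : Site (d + 1)) : x = translate T y m ↔ m = 0 ∧ x = y := by
  constructor
  · intro h
    have hq := congrArg (quo T) h
    rw [quo_translate T hy, ← translate_zero' T x, quo_translate T hx] at hq
    refine ⟨hq.symm, ?_⟩
    rw [h, ← hq, translate_zero']
  · rintro ⟨rfl, rfl⟩
    exact (translate_zero' T x).symm

/-! ## §2 The sym composite rows are the periodised composite leg -/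

section Main

variable (Lc : ℕ) [NeZero Lc] (ℓ : ℕ → Fin (d + 1) → Site (d + 1) → Bond (d + 1) → ℝ)

/-- [folklore] **`compRowsSym_apply_eq_tsum_compLinKer` — THE (0.4)-SYMMETRISED COMPOSITE ROWS ARE THE FINEST-TORUS PERIODISATION OF an2's COMPOSITE LINEAR KERNEL
AT THE SYM BRICKS**: for a brick list `ℓ` displayed below the depth as `stepScale d Lc (lev (n − i)) · Lc^{d+1} · symLinKerAt (ctr (d+1) Lc) Lc` (`hℓ`),
`compRowsSym Lc M lev rs n (x, κ) q = Σ'_m compLinKer ℓ Lc n (q.2, q.1 + (towerTorus Lc M n)∘m) (κ, x)` — every `tsum` finitely supported.  Induction on the depth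
(leaf-02's architecture: `compRowsSym_succ` on the torus side, `compLinKer_succ` on the lattice side, `sum_QstepSym_mul_periodic` at the top, the window of
`symLinKerAt` and `compLinKer_sh` for the periodicity of the lower leg; depth `0` = `translate_eq_iff_of_mem_pbox`). -/
theorem compRowsSym_apply_eq_tsum_compLinKer : ∀ (n : ℕ) (M : Fin (d + 1) → ℕ) [∀ μ, NeZero (M μ)] (lev : ℕ → ℕ) (rs : ℕ → (Fin (d + 1) → ℕ))
    (_ : ∀ i < n, ∀ (μ : Fin (d + 1)) (y : Site (d + 1)) (g : Bond (d + 1)),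
      ℓ i μ y g = stepScale d Lc (lev (n - i)) * ((Lc : ℝ) ^ (d + 1) * symLinKerAt (ctr (d + 1) Lc) Lc μ y g))
    (x : ↥(pbox M)) (κ : Fin (d + 1)) (q : ↥(pbox (towerTorus Lc M n)) × Fin (d + 1)),
    compRowsSym Lc M lev rs n (x, κ) q
      = ∑' m : Site (d + 1), compLinKer ℓ Lc n (q.2, translate (towerTorus Lc M n) (q.1 : Site (d + 1)) m) (κ, (x : Site (d + 1)))
  | 0, M, _, lev, rs, _, x, κ, q => by
      show (1 : Matrix (↥(pbox M) × Fin (d + 1)) (↥(pbox M) × Fin (d + 1)) ℝ) (x, κ) q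
        = ∑' m : Site (d + 1), compLinKer ℓ Lc 0 (q.2, translate M (q.1 : Site (d + 1)) m) (κ, (x : Site (d + 1)))
      simp only [compLinKer_zero]
      by_cases hq : (x, κ) = q
      · subst hq
        have h : ∀ m : Site (d + 1), (((κ, (x : Site (d + 1))) : Bond (d + 1)) = (κ, translate M (x : Site (d + 1)) m)) ↔ m = 0 := fun m => by
          rw [Prod.mk.injEq, translate_eq_iff_of_mem_pbox M x.2 x.2]
          simp only [true_and, and_true]
        simp_rw [h, Matrix.one_apply_eq]
        rw [tsum_eq_single (0 : Site (d + 1)) fun m hm => if_neg hm, if_pos rfl]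
      · rw [Matrix.one_apply_ne hq]
        have h : ∀ m : Site (d + 1), ¬ (((κ, (x : Site (d + 1))) : Bond (d + 1)) = (q.2, translate M (q.1 : Site (d + 1)) m)) := fun m hm => by
          rw [Prod.mk.injEq, translate_eq_iff_of_mem_pbox M x.2 q.1.2] at hm
          exact hq (Prod.ext (Subtype.ext hm.2.2) hm.1)
        simp_rw [if_neg (h _)]
        exact tsum_zero.symm
  | n + 1, M, _, lev, rs, hℓ, x, κ, q => by
      have hL1 : 1 ≤ Lc := Nat.one_le_iff_ne_zero.mpr (NeZero.ne Lc)
      -- `towerTorus Lc M (n+1)` is `towerTorus Lc (fine Lc M) n` by `rfl` (push-inside); name it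
      show compRowsSym Lc M lev rs (n + 1) (x, κ) q
        = ∑' m : Site (d + 1), compLinKer ℓ Lc (n + 1) (q.2, translate (towerTorus Lc (fine Lc M) n) (q.1 : Site (d + 1)) m) (κ, (x : Site (d + 1)))
      -- the lower composite, periodised: a `fine Lc M`-periodic form
      set T : Fin (d + 1) → ℕ := towerTorus Lc (fine Lc M) n with hTdef
      have hT : ∀ i, (T i : ℤ) = ((Lc : ℤ) ^ n) * ((Lc : ℤ) * (M i : ℤ)) := fun i => by
        rw [hTdef, towerTorus_apply]; push_cast; ring
      have IH := compRowsSym_apply_eq_tsum_compLinKer n (fine Lc M) (fun k => lev (k + 1)) (fun k => rs (k + 1))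
        (fun i hi μ y g => by rw [hℓ i (Nat.lt_succ_of_lt hi), show n + 1 - i = n - i + 1 by omega])
      set B : Form1 (d + 1) ℝ := fun l z => ∑' m : Site (d + 1), compLinKer ℓ Lc n (q.2, translate T (q.1 : Site (d + 1)) m) (l, z) with hBdef
      have hcov : ∀ i < n, ∀ (μ : Fin (d + 1)) (y t : Site (d + 1)) (g : Bond (d + 1)), ℓ i μ (y + t) (g.sh ((Lc : ℤ) • t)) = ℓ i μ y g :=
        fun i hi μ y t g => by rw [hℓ i (Nat.lt_succ_of_lt hi), hℓ i (Nat.lt_succ_of_lt hi), symLinKerAt_add]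
      have hB : ∀ (l : Fin (d + 1)) (y m' : Site (d + 1)), B l (translate (fine Lc M) y m') = B l y := by
        intro l y m'
        simp only [hBdef]
        set t : Site (d + 1) := fun i => ((Lc : ℤ) * (M i : ℤ)) * m' i with htdef
        have hy : ((l, translate (fine Lc M) y m') : Bond (d + 1)) = Bond.sh (l, y) t := by
          refine Prod.ext rfl (funext fun i => ?_)
          simp only [Bond.sh, B4TorusKernel.MultiPeriod.translate_apply, htdef, Pi.add_apply]
          push_cast; ring
        have hq' : ∀ m : Site (d + 1), ((q.2, translate T (q.1 : Site (d + 1)) m) : Bond (d + 1))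
            = Bond.sh (q.2, translate T (q.1 : Site (d + 1)) (m - m')) (((Lc : ℤ) ^ n) • t) := fun m => by
          refine Prod.ext rfl (funext fun i => ?_)
          simp only [Bond.sh, B4TorusKernel.MultiPeriod.translate_apply, htdef, Pi.add_apply, Pi.smul_apply, Pi.sub_apply, smul_eq_mul, hT]
          ring
        calc ∑' m : Site (d + 1), compLinKer ℓ Lc n (q.2, translate T (q.1 : Site (d + 1)) m) (l, translate (fine Lc M) y m')
            = ∑' m : Site (d + 1), compLinKer ℓ Lc n (q.2, translate T (q.1 : Site (d + 1)) (m - m')) (l, y) :=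
              tsum_congr fun m => by rw [hy, hq' m, compLinKer_sh ℓ Lc n hcov]
          _ = ∑' m : Site (d + 1), compLinKer ℓ Lc n (q.2, translate T (q.1 : Site (d + 1)) m) (l, y) :=
              (Equiv.subRight m').tsum_eq (fun m => compLinKer ℓ Lc n (q.2, translate T (q.1 : Site (d + 1)) m) (l, y))
      -- the torus side: top peel, the lower rows by induction, leaf-02's one-step pairing
      have lhs : compRowsSym Lc M lev rs (n + 1) (x, κ) q
          = stepScale d Lc (lev 1) * ((Lc : ℝ) ^ (d + 1)
              * ∑' z : Site (d + 1), ∑ l : Fin (d + 1), symLinKerAt (ctr (d + 1) Lc) Lc κ (x : Site (d + 1)) (l, z) * B l z) := by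
        rw [compRowsSym_succ, Matrix.mul_apply, ← sum_QstepSym_mul_periodic Lc M (lev 1) B hB x κ]
        refine Finset.sum_congr rfl fun p _ => ?_
        obtain ⟨y, l⟩ := p
        rw [IH y l q]
      -- the lattice side: an2's top peel at the displayed top brick
      have htop : ∀ g : Bond (d + 1), ℓ n κ (x : Site (d + 1)) g
          = stepScale d Lc (lev 1) * ((Lc : ℝ) ^ (d + 1) * symLinKerAt (ctr (d + 1) Lc) Lc κ (x : Site (d + 1)) g) := fun g => by
        rw [hℓ n (Nat.lt_succ_self n), Nat.add_sub_cancel_left]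
      have rhs : ∀ m : Site (d + 1), compLinKer ℓ Lc (n + 1) (q.2, translate T (q.1 : Site (d + 1)) m) (κ, (x : Site (d + 1)))
          = stepScale d Lc (lev 1) * ((Lc : ℝ) ^ (d + 1) * ∑ e ∈ offs Lc, ∑ l : Fin (d + 1),
              symLinKerAt (ctr (d + 1) Lc) Lc κ (x : Site (d + 1)) (l, (Lc : ℤ) • (x : Site (d + 1)) + e)
                * compLinKer ℓ Lc n (q.2, translate T (q.1 : Site (d + 1)) m) (l, (Lc : ℤ) • (x : Site (d + 1)) + e)) := fun m => by
        rw [compLinKer_succ, Finset.sum_comm, Finset.mul_sum, Finset.mul_sum]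
        refine Finset.sum_congr rfl fun e _ => ?_
        rw [Finset.mul_sum, Finset.mul_sum]
        exact Finset.sum_congr rfl fun l _ => by rw [htop]; ring
      -- the window of the top brick: the `z`-sum is the window sum
      have hwin : ∑' z : Site (d + 1), ∑ l : Fin (d + 1), symLinKerAt (ctr (d + 1) Lc) Lc κ (x : Site (d + 1)) (l, z) * B l z
          = ∑ e ∈ offs Lc, ∑ l : Fin (d + 1), symLinKerAt (ctr (d + 1) Lc) Lc κ (x : Site (d + 1)) (l, (Lc : ℤ) • (x : Site (d + 1)) + e)
              * B l ((Lc : ℤ) • (x : Site (d + 1)) + e) := by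
        have h0 : ∀ z ∉ (offs Lc).image (fun e : Site (d + 1) => (Lc : ℤ) • (x : Site (d + 1)) + e),
            ∑ l : Fin (d + 1), symLinKerAt (ctr (d + 1) Lc) Lc κ (x : Site (d + 1)) (l, z) * B l z = 0 := by
          intro z hz
          refine Finset.sum_eq_zero fun l _ => ?_
          have hnz : ¬ Near Lc (x : Site (d + 1)) z := fun h => hz (by
            obtain ⟨e, he, rfl⟩ := near_iff_exists_offs.1 h
            exact Finset.mem_image.2 ⟨e, he, rfl⟩)
          rw [show ctr (d + 1) Lc = toSite (ctrOff (d + 1) Lc) from rfl, symLinKerAt_eq_zero (ctrOff_mem_box hL1) (f := (l, z)) hnz, zero_mul]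
        rw [tsum_eq_sum h0, Finset.sum_image fun e _ e' _ h => smul_add_right_injective Lc (x : Site (d + 1)) h]
      -- summability in `m` of the lower leg at a fixed coarse bond (finite support, `translate` injective)
      have hsum : ∀ g : Bond (d + 1), Summable fun m : Site (d + 1) => compLinKer ℓ Lc n (q.2, translate T (q.1 : Site (d + 1)) m) g := by
        intro g
        have hinj : Function.Injective fun m : Site (d + 1) => ((q.2, translate T (q.1 : Site (d + 1)) m) : Bond (d + 1)) :=
          fun m m' h => translate_injective (fun i => Nat.one_le_iff_ne_zero.mpr (NeZero.ne (T i))) _ (congrArg Prod.snd h)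
        have hfin := (finite_compLinKer_ne_zero_left ℓ Lc n g).preimage hinj.injOn
        refine summable_of_ne_finset_zero (s := hfin.toFinset) fun m hm => ?_
        by_contra h
        exact hm (hfin.mem_toFinset.2 h)
      rw [lhs, hwin]
      simp_rw [rhs]
      rw [tsum_mul_left, tsum_mul_left, Summable.tsum_finsetSum fun e _ => summable_sum fun l _ => (hsum _).mul_left _]
      congr 2
      refine Finset.sum_congr rfl fun e _ => ?_
      rw [Summable.tsum_finsetSum fun l _ => (hsum _).mul_left _]
      refine Finset.sum_congr rfl fun l _ => ?_
      rw [tsum_mul_left]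

end Main

/-! ## §3 The engine's letters for this leg -/

section EngineLetters

variable (Lc : ℕ) [NeZero Lc] (M : Fin (d + 1) → ℕ) [∀ μ, NeZero (M μ)] (lev : ℕ → ℕ) (rs : ℕ → (Fin (d + 1) → ℕ)) (n : ℕ)
  (ℓ : ℕ → Fin (d + 1) → Site (d + 1) → Bond (d + 1) → ℝ)

omit [NeZero Lc] [∀ μ, NeZero (M μ)] in
/-- [folklore] **THE ENGINE's `hCL` FOR THE COMPOSITE SYM LEG**: `CL γ a β b := compLinKer ℓ Lc n (b, β) (a, γ)` is EQUIVARIANT under simultaneous translation by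
`Tc := M` (coarse) and `Tf := towerTorus Lc M n` (fine) — `compLinKer_sh` at `t := M∘m`, the bricks' covariance being an1's `symLinKerAt_add`. -/
theorem rowsLeg_translate
    (hℓ : ∀ i < n, ∀ (μ : Fin (d + 1)) (y : Site (d + 1)) (g : Bond (d + 1)),
      ℓ i μ y g = stepScale d Lc (lev (n - i)) * ((Lc : ℝ) ^ (d + 1) * symLinKerAt (ctr (d + 1) Lc) Lc μ y g))
    (m γ : Site (d + 1)) (a : Fin (d + 1)) (β : Site (d + 1)) (b : Fin (d + 1)) :
    compLinKer ℓ Lc n (b, translate (towerTorus Lc M n) β m) (a, translate M γ m) = compLinKer ℓ Lc n (b, β) (a, γ) := by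
  have hcov : ∀ i < n, ∀ (μ : Fin (d + 1)) (y t : Site (d + 1)) (g : Bond (d + 1)), ℓ i μ (y + t) (g.sh ((Lc : ℤ) • t)) = ℓ i μ y g :=
    fun i hi μ y t g => by rw [hℓ i hi, hℓ i hi, symLinKerAt_add]
  set t : Site (d + 1) := fun i => (M i : ℤ) * m i with ht
  have h1 : ((a, translate M γ m) : Bond (d + 1)) = Bond.sh (a, γ) t :=
    Prod.ext rfl (funext fun i => by simp only [Bond.sh, B4TorusKernel.MultiPeriod.translate_apply, ht, Pi.add_apply])
  have h2 : ((b, translate (towerTorus Lc M n) β m) : Bond (d + 1)) = Bond.sh (b, β) (((Lc : ℤ) ^ n) • t) := by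
    refine Prod.ext rfl (funext fun i => ?_)
    simp only [Bond.sh, B4TorusKernel.MultiPeriod.translate_apply, ht, Pi.add_apply, Pi.smul_apply, smul_eq_mul, towerTorus_apply]
    push_cast; ring
  rw [h1, h2, compLinKer_sh ℓ Lc n hcov]

omit [∀ μ, NeZero (M μ)] in
/-- [folklore] **THE ENGINE's `S ∕ hS` FOR THE COMPOSITE SYM LEG**: a finite window `S β` of coarse sites per fine site, off which the leg vanishes for every fibre pair
(`finite_compLinKer_ne_zero_right`; no letter of the bricks). -/
theorem exists_rowsLeg_window :
    ∃ S : Site (d + 1) → Finset (Site (d + 1)), ∀ (γ : Site (d + 1)) (a : Fin (d + 1)) (β : Site (d + 1)) (b : Fin (d + 1)),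
      γ ∉ S β → compLinKer ℓ Lc n (b, β) (a, γ) = 0 := by
  have hfin : ∀ β : Site (d + 1), Set.Finite {γ : Site (d + 1) | ∃ (a b : Fin (d + 1)), compLinKer ℓ Lc n (b, β) (a, γ) ≠ 0} := fun β => by
    refine (Set.finite_iUnion fun b : Fin (d + 1) => (finite_compLinKer_ne_zero_right ℓ Lc (NeZero.ne Lc) n (b, β)).image Prod.snd).subset ?_
    rintro γ ⟨a, b, h⟩
    exact Set.mem_iUnion.2 ⟨b, (a, γ), h, rfl⟩
  refine ⟨fun β => (hfin β).toFinset, fun γ a β b hγ => ?_⟩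
  by_contra h
  exact hγ ((hfin β).mem_toFinset.2 ⟨a, b, h⟩)

/-- [folklore] **THE ENGINE's `hCm ∕ hC` FOR THE COMPOSITE SYM LEG**: `compRowsSym Lc M lev rs n p q = Σ'_m CL p.1 p.2 (q.1 + (towerTorus Lc M n)∘m) q.2` with
`CL γ a β b := compLinKer ℓ Lc n (b, β) (a, γ)` (§2, every pair of indices). -/
theorem compRowsSym_eq_periodised_leg
    (hℓ : ∀ i < n, ∀ (μ : Fin (d + 1)) (y : Site (d + 1)) (g : Bond (d + 1)),
      ℓ i μ y g = stepScale d Lc (lev (n - i)) * ((Lc : ℝ) ^ (d + 1) * symLinKerAt (ctr (d + 1) Lc) Lc μ y g))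
    (p : ↥(pbox M) × Fin (d + 1)) (q : ↥(pbox (towerTorus Lc M n)) × Fin (d + 1)) :
    compRowsSym Lc M lev rs n p q
      = ∑' m : Site (d + 1), compLinKer ℓ Lc n (q.2, translate (towerTorus Lc M n) (q.1 : Site (d + 1)) m) (p.2, (p.1 : Site (d + 1))) := by
  obtain ⟨x, κ⟩ := p
  exact compRowsSym_apply_eq_tsum_compLinKer Lc ℓ n M lev rs hℓ x κ q

end EngineLetters

end Summit.QuantumFields.BalabanUV.Beta.FP.TorusCompositeRowsSymKernel

end
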